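import Summits.Ventures.HodgeRepro2.T5SU11ResolventOfDecaySolution

/-!
# The logarithmic singularities of two decaying solutions cancel:
`χ_λ(t) − χ_{λ₂}(t) → −(μ − μ₂) ∫_0^∞ χ_λ χ_{λ₂} sinh 2s ds` as `t → 0⁺`

Row 643's `G^I_{λ₂} χ_λ = (χ_λ − χ_{λ₂})/(μ − μ₂)` is read at the origin. The resolvent of the singular source `χ_λ` still has a
boundary value there: in `G^I_{λ₂} χ_λ = −χ_{λ₂} B^I − φ_{λ₂} A^I`, the inner integral satisfies `|B^I(t)| ≤ Φ t` for small `t`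
(`χ_λ sinh 2s → 0`), so `χ_{λ₂}(t) B^I(t) → 0` (`t χ_{λ₂}(t) → 0`), while `A^I(t) → ∫_0^∞ χ_{λ₂} χ_λ sinh 2s ds` (row 625) and
`φ_{λ₂}(a_t) → 1`:

* `abs_greenBI_sphDecay_le` — `|B^I(t)| ≤ Φ t` for small `t`;
* `tendsto_mul_sphDecay_nhdsGT_zero` — `t χ_λ(t) → 0`;
* `tendsto_greenSolI_sphDecay_nhdsGT_zero` — **`G^I_{λ₂} χ_λ(t) → −∫_0^∞ χ_{λ₂} χ_λ sinh 2s ds`** as `t → 0⁺`;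
* `tendsto_sphDecay_sub_nhdsGT_zero` — **`χ_λ(t) − χ_{λ₂}(t) → −(μ − μ₂) ∫_0^∞ χ_{λ₂} χ_λ sinh 2s ds`**: the difference of two
  decaying solutions extends continuously to the origin — every `χ_λ` carries the same logarithmic singularity;
* `integral_sphDecay_mul_sphDecay_eq_lim` — equivalently, the mass `∫_0^∞ χ_{λ₂} χ_λ sinh 2s ds` is the limit of
  `(χ_{λ₂} − χ_λ)/(μ − μ₂)` at the origin.

Nothing is claimed about (N).

Blind lane: Mathlib + the HodgeRepro2 prefix only; no sorry; axioms ⊆ {propext, Classical.choice,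
Quot.sound}.
-/

namespace Summit.Ventures.HodgeRepro2.T5SU11SphericalDecayDifferenceOrigin

open Filter Topology MeasureTheory
open Set (Ioi Ioc Icc)
open T5SU11Cartan T5SU11SphericalFunction T5SU11SphericalBounds T5SU11SphericalContinuous T5SU11SphericalDecay
  T5SU11ReductionOfOrder T5SU11RadialGreenKernel T5SU11RadialGreenImproper T5SU11RadialGreenImproperOrigin
  T5SU11ResolventOrigin T5SU11SphericalDecayOriginFlux T5SU11SphericalDecayFluxIdentity T5SU11ResolventCommute
  T5SU11ResolventOfDecaySolution

section measure

variable [MeasurableSpace Circle] [BorelSpace Circle]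

variable {lam lam₂ : ℝ} (hlam : 1 < lam) (hlam₂ : 1 < lam₂)

include hlam in
/-- **`t χ_λ(t) → 0` as `t → 0⁺`** (`2t ≤ sinh 2t` and row 633). -/
theorem tendsto_mul_sphDecay_nhdsGT_zero : Tendsto (fun t => t * sphDecay lam t) (𝓝[>] 0) (𝓝 0) := by
  have h := tendsto_sinh_mul_sphDecay_nhdsGT_zero hlam
  refine squeeze_zero_norm' ?_ (by simpa using h.const_mul (1 / 2 : ℝ))
  filter_upwards [self_mem_nhdsWithin] with t ht
  have ht' : (0 : ℝ) < t := ht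
  have hχ : 0 < sphDecay lam t := sphDecay_pos hlam ht'
  have hs : 2 * t ≤ Real.sinh (2 * t) := Real.self_le_sinh_iff.mpr (by linarith)
  rw [Real.norm_eq_abs, abs_of_pos (mul_pos ht' hχ)]
  nlinarith

include hlam in
/-- **`|B^I(t)| ≤ Φ t`** for `0 < t ≤ δ`, where `φ_{λ₂} ≤ Φ` on `[0, 1]` and `χ_λ sinh 2s ≤ 1` on `(0, δ]`. -/
theorem abs_greenBI_sphDecay_le {Φ : ℝ} (hΦ : ∀ u ∈ Icc (0 : ℝ) 1, sph lam₂ (hyp u) ≤ Φ) (hΦ0 : 0 ≤ Φ)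
    {δ : ℝ} (hδ1 : δ ≤ 1) (hδ : ∀ s, 0 < s → s ≤ δ → sphDecay lam s * Real.sinh (2 * s) ≤ 1)
    {t : ℝ} (ht : 0 < t) (htδ : t ≤ δ) :
    |greenBI (fun t => sph lam₂ (hyp t)) (sphDecay lam) t| ≤ Φ * t := by
  unfold greenBI
  have h := norm_setIntegral_le_of_norm_le_const (μ := volume) (s := Ioc 0 t)
    (f := fun s => sph lam₂ (hyp s) * sphDecay lam s * Real.sinh (2 * s)) (C := Φ)
    (by rw [Real.volume_Ioc]; exact ENNReal.ofReal_lt_top) (fun s hs => ?_)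
  · rw [Real.norm_eq_abs, Real.volume_real_Ioc_of_le ht.le, sub_zero] at h
    exact h
  · have hs0 : 0 < s := hs.1
    have hsδ : s ≤ δ := le_trans hs.2 htδ
    rw [Real.norm_eq_abs, abs_mul, abs_mul, abs_of_pos (sph_hyp_pos lam₂ s), abs_of_pos (sphDecay_pos hlam hs0),
      abs_of_pos (sinh_two_mul_pos hs0), mul_assoc]
    have h1 : sph lam₂ (hyp s) ≤ Φ := hΦ s ⟨hs0.le, le_trans hsδ hδ1⟩
    have h2 := hδ s hs0 hsδ
    have h3 : 0 ≤ sphDecay lam s * Real.sinh (2 * s) := (mul_pos (sphDecay_pos hlam hs0) (sinh_two_mul_pos hs0)).le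
    calc sph lam₂ (hyp s) * (sphDecay lam s * Real.sinh (2 * s)) ≤ Φ * 1 :=
          mul_le_mul h1 h2 h3 hΦ0
      _ = Φ := mul_one Φ

include hlam hlam₂ in
/-- **`G^I_{λ₂} χ_λ(t) → −∫_0^∞ χ_{λ₂} χ_λ sinh 2s ds` as `t → 0⁺`**: the resolvent of the singular source `χ_λ` has a boundary
value at the origin. -/
theorem tendsto_greenSolI_sphDecay_nhdsGT_zero :
    Tendsto (greenSolI (fun t => sph lam₂ (hyp t)) (sphDecay lam₂) (sphDecay lam)) (𝓝[>] 0)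
      (𝓝 (-∫ s in Ioi 0, sphDecay lam₂ s * sphDecay lam s * Real.sinh (2 * s))) := by
  have hA := integrableOn_sphDecay_mul_sphDecay_mul_sinh hlam hlam₂
  obtain ⟨Φ, hΦ0, hΦ⟩ := exists_sph_hyp_le lam₂
  -- `χ_λ sinh 2s ≤ 1` on some `(0, δ]`
  obtain ⟨δ, hδ0, hδ1, hδ⟩ : ∃ δ : ℝ, 0 < δ ∧ δ ≤ 1 ∧ ∀ s, 0 < s → s ≤ δ → sphDecay lam s * Real.sinh (2 * s) ≤ 1 := by
    have h := (tendsto_sinh_mul_sphDecay_nhdsGT_zero hlam).eventually (eventually_abs_sub_lt 0 one_pos)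
    rw [eventually_nhdsWithin_iff] at h
    obtain ⟨ε, hε0, hε⟩ := Metric.eventually_nhds_iff.mp h
    refine ⟨min (ε / 2) 1, by positivity, min_le_right _ _, fun s hs0 hsδ => ?_⟩
    have hsε : s < ε := lt_of_le_of_lt (le_trans hsδ (min_le_left _ _)) (by linarith)
    have := hε (show dist s 0 < ε by rw [Real.dist_eq, sub_zero, abs_of_pos hs0]; exact hsε) hs0
    rw [sub_zero] at this
    have := (abs_lt.mp this).2
    linarith
  -- `χ_{λ₂}(t) B^I(t) → 0`
  have hχB : Tendsto (fun t => sphDecay lam₂ t * greenBI (fun t => sph lam₂ (hyp t)) (sphDecay lam) t) (𝓝[>] 0) (𝓝 0) := by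
    have hlim : Tendsto (fun t => Φ * (t * sphDecay lam₂ t)) (𝓝[>] 0) (𝓝 0) := by
      simpa using (tendsto_mul_sphDecay_nhdsGT_zero hlam₂).const_mul Φ
    refine squeeze_zero_norm' ?_ hlim
    filter_upwards [Ioc_mem_nhdsGT hδ0] with t ht
    have hB := abs_greenBI_sphDecay_le hlam hΦ hΦ0.le hδ1 hδ ht.1 ht.2
    have hχ : 0 < sphDecay lam₂ t := sphDecay_pos hlam₂ ht.1
    rw [Real.norm_eq_abs, abs_mul, abs_of_pos hχ]
    calc sphDecay lam₂ t * |greenBI (fun t => sph lam₂ (hyp t)) (sphDecay lam) t| ≤ sphDecay lam₂ t * (Φ * t) :=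
          mul_le_mul_of_nonneg_left hB hχ.le
      _ = Φ * (t * sphDecay lam₂ t) := by ring
  -- `A^I(t) → ∫_{(0,∞)} χ_{λ₂} χ_λ sinh` and `φ_{λ₂}(a_t) → 1`
  have hA' := tendsto_greenAI_nhdsGT_zero (lam := lam₂) (g := sphDecay lam) hA
  have hφ : Tendsto (fun t => sph lam₂ (hyp t)) (𝓝[>] 0) (𝓝 1) := by
    have h : Tendsto (fun t => sph lam₂ (hyp t)) (𝓝[>] 0) (𝓝 (sph lam₂ (hyp 0))) :=
      ((continuous_sph_hyp lam₂).tendsto 0).mono_left (nhdsWithin_le_nhds (s := Ioi 0))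
    rwa [T5SU11OneParameter.hyp_zero, sph_one] at h
  have h2 := hφ.mul hA'
  rw [one_mul] at h2
  have h := (hχB.neg).sub h2
  rw [neg_zero, zero_sub] at h
  exact h

include hlam hlam₂ in
/-- **THE LOGARITHMIC SINGULARITIES CANCEL**: `χ_λ(t) − χ_{λ₂}(t) → −(μ − μ₂) ∫_0^∞ χ_{λ₂} χ_λ sinh 2s ds` as `t → 0⁺`. -/
theorem tendsto_sphDecay_sub_nhdsGT_zero (hne : lam ≠ lam₂) :
    Tendsto (fun t => sphDecay lam t - sphDecay lam₂ t) (𝓝[>] 0)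
      (𝓝 (-((lam * (lam - 2) - lam₂ * (lam₂ - 2)) * ∫ s in Ioi 0, sphDecay lam₂ s * sphDecay lam s * Real.sinh (2 * s)))) := by
  have hκ : lam * (lam - 2) - lam₂ * (lam₂ - 2) ≠ 0 := (mu_sub_ne_zero hlam hlam₂).mpr hne
  have h := (tendsto_greenSolI_sphDecay_nhdsGT_zero hlam hlam₂).const_mul (lam * (lam - 2) - lam₂ * (lam₂ - 2))
  have e : (lam * (lam - 2) - lam₂ * (lam₂ - 2)) * -∫ s in Ioi 0, sphDecay lam₂ s * sphDecay lam s * Real.sinh (2 * s)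
      = -((lam * (lam - 2) - lam₂ * (lam₂ - 2)) * ∫ s in Ioi 0, sphDecay lam₂ s * sphDecay lam s * Real.sinh (2 * s)) := by
    ring
  rw [e] at h
  refine h.congr' ?_
  filter_upwards [self_mem_nhdsWithin] with t ht
  rw [greenSolI_sphDecay_eq hlam hlam₂ hne ht]
  field_simp

include hlam hlam₂ in
/-- The mass `∫_0^∞ χ_{λ₂} χ_λ sinh 2s ds` as a limit at the origin: `(χ_{λ₂}(t) − χ_λ(t))/(μ − μ₂) → ∫_0^∞ χ_{λ₂} χ_λ sinh 2s ds`. -/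
theorem tendsto_sphDecay_sub_div_nhdsGT_zero (hne : lam ≠ lam₂) :
    Tendsto (fun t => (sphDecay lam₂ t - sphDecay lam t) / (lam * (lam - 2) - lam₂ * (lam₂ - 2))) (𝓝[>] 0)
      (𝓝 (∫ s in Ioi 0, sphDecay lam₂ s * sphDecay lam s * Real.sinh (2 * s))) := by
  have hκ : lam * (lam - 2) - lam₂ * (lam₂ - 2) ≠ 0 := (mu_sub_ne_zero hlam hlam₂).mpr hne
  have h := ((tendsto_sphDecay_sub_nhdsGT_zero hlam hlam₂ hne).div_const (lam * (lam - 2) - lam₂ * (lam₂ - 2))).neg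
  have e : -(-((lam * (lam - 2) - lam₂ * (lam₂ - 2)) * ∫ s in Ioi 0, sphDecay lam₂ s * sphDecay lam s * Real.sinh (2 * s))
      / (lam * (lam - 2) - lam₂ * (lam₂ - 2))) = ∫ s in Ioi 0, sphDecay lam₂ s * sphDecay lam s * Real.sinh (2 * s) := by
    field_simp
  rw [e] at h
  refine h.congr' (Eventually.of_forall fun t => ?_)
  ring

end measure

end Summit.Ventures.HodgeRepro2.T5SU11SphericalDecayDifferenceOrigin
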